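import Summits.QuantumFields.YangMills.Theorems.UnitScaleTiltProp7CovariantWeitzenbock
import HarnessLib

/-!
# Route `UnitScaleTilt`, crux K1 child «MinimiserStabilityRegPr» (stmt-QuantumFields-19200), registered stub `stub_prop7From14` (v4 828f5fb4a904d3be;
# leaf V3 «Prop 7 from a background (14)» = `T3Thm1CarrierNative.Prop7From14At`) — sub-lemma V3-D1b∕D2 at a NON-FLAT background, part 3/3:
# [Balaban1985BackgroundPropagators] THM 3.11 IN `L²` FORM AT A SMALL-FIELD BACKGROUND, `k`-UNIFORM — the covariant curl and divergence forms control
# `L^{−2k}·Σ_b‖Y(b)‖²` on the kernel of the covariant straight-line averaging, with ABSOLUTE smallness and constants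

Cell `ym3-torus` ∕ fleet seat `ym-ust-19200-p1` (HUMAN RULING D-0037, YM ladder rung R3), successor g2.  WHERE THIS SITS.  [Balaban1985BackgroundPropagators]
Thm 3.11 (p. 416): for backgrounds `U₀ ∈ 𝔘_k(ε)`, `ε` «sufficiently small», the operator `Δ₁(U₀) + D R D^* + aQ^*Q` is bounded below by `γ₀η²` uniformly in `k`
and in the volume — the positivity that makes [Balaban1985Variational] Prop. 7's critical point a minimum ((141)–(143)) and drives the contraction of Sects. D–E.
THIS FILE composes the two kernel-checked halves landed by this seat at the concrete carrier: V3-D2 (`UnitScaleTiltProp7CovariantCoercivity`: `L^{−2e}Σ‖Y‖² ≤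
(9N/2)Σ‖∇^VY‖²` on `ker` of the covariant straight-line averaging when `N d³((L^e)²a)² ≤ ½`) and the quadratic-form Weitzenböck at a unitary background
(`UnitScaleTiltProp7CovariantWeitzenbock`: `Σ‖D_{V,ν}Y_μ‖²_HS ≤ Σ_p‖D_VY(p)‖²_HS + Σ_x‖D^*_VY(x)‖²_HS + 2da·Σ‖Y‖²_HS`), through the dictionary
`plaqU (κ,z ↦ V(z,z+e_κ)) μ ν x = V(∂p_{μν}(x))` (`plaqU_eq_holT`) and the norm comparisons `‖X‖² ≤ Σ|X_jk|² ≤ N‖X‖²`.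

WHAT IS PROVED (sorry-free, no definition; our own statements — [folklore] ∕ cited to the printed step they instantiate):
* `plaqU_eq_holT`, `plaqU_hyp` — the plaquette hypothesis of the `B9Eq39Adjoint` calculus from the torus one (`‖V(∂p) − 1‖ ≤ a`, both orientations; the diagonal is
  the trivial loop);
* **`sum_normSq_le_curl_sq_add_divB_sq`** — on `T^{(i)}`, `e` levels above `T^{(i')}`, unitary `V` with plaquette variables within `a` of `1`, `N d³((L^e)²a)² ≤ ½`,
  `Y` with vanishing covariant straight-line block averages: `((L^e)^{−2} − 9N²d·a)·Σ_b‖Y(b)‖² ≤ (9N/2)·(Σ_{x,μ<ν}‖(D_VY)(p_{μν}(x))‖²_HS + Σ_x‖(D^*_VY)(x)‖²_HS)`;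
* **`sum_normSq_le_curl_sq_add_divB_sq_T3`** — at the d = 3 carrier (`Site (F.P K) 0`, `e = K − n`, `SU(2)` read through `unitsField ∘ toUField`):
  `dist1(U₀(∂p)) ≤ εL^{−2(K−n)}`, `216ε ≤ 1`, `A^{U₀}Y = 0 ⇒ L^{−2(K−n)}Σ_b‖Y(b)‖² ≤ 18·(Σ_{x,μ<ν}‖(D_{U₀}Y)(p_{μν}(x))‖²_HS + Σ_x‖(D^*_{U₀}Y)(x)‖²_HS)`,
  uniformly in `m`, `n`, `K`.

WHAT THIS IS NOT.  Print's operator has the residual-gauge form `DRD^*` ([Balaban1984PropagatorsI] (1.72), `R = I − P`) where this file has the full divergence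
form `DD^*` (Landau gauge `D^*Y = 0` kills both), and print's `Q` is the derivative of the (0.4)-averaging at `U₀` where this file has the covariant straight-line
block average (main term; the identification with its contour and `exp`-mean-`log` corrections is the split card's D1c); the sup-norm ∕ decay theory of
Thms 3.12–3.13 (D3) and the Sects. B–E assembly of Prop. 7 are untouched.  Nothing of Bałaban's is asserted.

References: T. Bałaban, CMP 99 (1985) 389–434 [Balaban1985BackgroundPropagators] (Thm 3.11 p.416, (3.1)–(3.4) pp.390–391, (3.8)–(3.10) p.392); CMP 102 (1985)
277–309 [Balaban1985Variational] ((14) p.280, (135) p.298, (141)–(143) p.299); CMP 95 (1984) 17–40 [Balaban1984PropagatorsI] ((1.72) p.29, (1.90) p.33).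
-/

noncomputable section

open scoped BigOperators Matrix.Norms.L2Operator Matrix

namespace Summit.QuantumFields.YangMills.Theorems.Prop7CovariantCoercivity

open Literature.MathematicalPhysics.QuantumFieldTheory.Balaban1983to89
open Finset B1RG242Torus
open B7Prop1Explicit (plaqWord U1)
open B7Eq78Linearization (conjR conjR_apply)
open B9Eq39Adjoint (R R_def covD covDstar curl divB divP plaqU curl_self curl_swap sum_covD_mul sum_sum_covD_mul sum_curl_mul trace_R)
open B11Eq135Weitzenbock (vecLap curvOp hodgeOp transp plaqU' eq135_torus vecLap_def curvOp_def hodgeOp_def norm_plaqU'_sub_one_le)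
open B9TorusCalculus (torusT torusT_apply torusT_symm_apply torusT_comm)

variable {N : ℕ} [NeZero N]

/-! ## §3 [Balaban1985BackgroundPropagators] Thm 3.11 in `L²` form at a small-field background: the covariant curl and divergence forms control
`L^{−2e}·Σ‖Y‖²` on the kernel of the covariant straight-line averaging, `k`-uniformly -/

section Thm311

open B10StarCount (sum_pbond)
open B10Eq27TorusAxialLog (holT holT_plaqWord unitsField toUField unitsField_mem_unitaryUnits)
open B7Prop1Explicit (treeWord)

variable {P : Params} {i i' e : ℕ}

omit [NeZero N] in
/-- The plaquette variable of the `B9Eq39Adjoint` calculus at the background `(κ, z) ↦ V(z, z+e_κ)` IS the torus transport of `V` around the plaquette word.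
[cite: Balaban1985BackgroundPropagators, (3.1) p.390] -/
theorem plaqU_eq_holT (V : GaugeField P i (Matrix (Fin N) (Fin N) ℂ)ˣ) (μ ν : Fin P.d) (x : Site P i) :
    plaqU (torusT P i) (fun κ z => V ⟨z, κ⟩) μ ν x = holT V x (plaqWord μ ν) := by
  rw [holT_plaqWord]; rfl

omit [NeZero N] in
/-- The plaquette hypothesis of the `B9Eq39Adjoint` calculus from the torus one (the diagonal `μ = ν` is the trivial loop).
[cite: Balaban1985BackgroundPropagators, (3.1) p.390] -/
theorem plaqU_hyp {V : GaugeField P i (Matrix (Fin N) (Fin N) ℂ)ˣ} {a : ℝ} (ha : 0 ≤ a)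
    (hplaq : ∀ (x : Site P i) (κ μ : Fin P.d), κ ≠ μ → ‖((holT V x (plaqWord κ μ) : (Matrix (Fin N) (Fin N) ℂ)ˣ) : Matrix (Fin N) (Fin N) ℂ) - 1‖ ≤ a) :
    ∀ (μ ν : Fin P.d) (x : Site P i), ‖(plaqU (torusT P i) (fun κ z => V ⟨z, κ⟩) μ ν x : Matrix (Fin N) (Fin N) ℂ) - 1‖ ≤ a := by
  intro μ ν x
  by_cases hμν : μ = ν
  · subst hμν
    have : plaqU (torusT P i) (fun κ z => V ⟨z, κ⟩) μ μ x = 1 := by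
      rw [plaqU]; group
    rw [this, Units.val_one, sub_self, norm_zero]; exact ha
  · rw [plaqU_eq_holT]; exact hplaq x μ ν hμν

/-- **[B9] THM 3.11 IN `L²` FORM AT A SMALL-FIELD BACKGROUND, `k`-UNIFORM** (the composition of V3-D2 `sum_normSq_le_covGrad_of_covLineAvg_eq_zero` with the
quadratic-form Weitzenböck `sum_covD_sq_le_curl_sq_add_divB_sq`): on the torus `T^{(i)}`, `e` block levels above `T^{(i')}`, for a unitary background `V` whose
plaquette variables are within `a` of `1`, `N d³((L^e)²a)² ≤ ½`, and every `M_N(ℂ)`-valued bond field `Y` whose covariant straight-line block averages vanish,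
`((L^e)^{−2} − 9N²d·a)·Σ_b ‖Y(b)‖² ≤ (9N/2)·(Σ_{x,μ<ν} ‖(D_VY)(p_{μν}(x))‖²_HS + Σ_x ‖(D*_VY)(x)‖²_HS)`
(operator norms on the left, `‖X‖²_HS = Σ_{jk}|X_jk|²` on the right; `D_V`, `D*_V` the covariant curl (3.4) and divergence (3.8) of [Balaban1985BackgroundPropagators]
in the tree's `B9Eq39Adjoint` calculus at `(κ, z) ↦ V(z, z+e_κ)`).  At print's scaling `a = εL^{−2e}` the left coefficient is `(1 − 9N²dε)L^{−2e}`: for `ε` below an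
ABSOLUTE threshold the covariant curl and divergence forms bound `L^{−2e}Σ‖Y‖²` from above on `ker` of the covariant averaging — uniformly in the volume and in `e`.
[cite: Balaban1985BackgroundPropagators, Thm 3.11 p.416; Balaban1985Variational, (135) p.298] -/
theorem sum_normSq_le_curl_sq_add_divB_sq {V : GaugeField P i (Matrix (Fin N) (Fin N) ℂ)ˣ}
    (hVu : ∀ b, (V b : Matrix (Fin N) (Fin N) ℂ) ∈ unitary (Matrix (Fin N) (Fin N) ℂ)) {a : ℝ} (ha : 0 ≤ a)
    (hplaq : ∀ (x : Site P i) (κ μ : Fin P.d), κ ≠ μ → ‖((holT V x (plaqWord κ μ) : (Matrix (Fin N) (Fin N) ℂ)ˣ) : Matrix (Fin N) (Fin N) ℂ) - 1‖ ≤ a)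
    (hsmall : N * P.d ^ 3 * (((P.L : ℝ) ^ e) ^ 2 * a) ^ 2 ≤ 1 / 2)
    (h : P.sitesPerDir i = P.L ^ e * P.sitesPerDir i') (Y : PBond P i → Matrix (Fin N) (Fin N) ℂ)
    (havg : ∀ c : PBond P i', ∑ r : Fin P.d → Fin (P.L ^ e), ∑ t ∈ range (P.L ^ e),
        conjR (holT V (Site.fibreSite i e c.src fun _ => ⟨0, pow_pos P.L_pos e⟩) (treeWord fun ν => ((r ν : ℕ) : ℤ))
            * holT V (Site.fibreSite i e c.src r) (List.replicate t (c.dir, true)))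
          (Y ⟨(fun z : Site P i => z.shift c.dir)^[t] (Site.fibreSite i e c.src r), c.dir⟩) = 0) :
    ((((P.L : ℝ) ^ e) ^ 2)⁻¹ - 9 * N ^ 2 * P.d * a) * ∑ b : PBond P i, ‖Y b‖ ^ 2
      ≤ (9 * N / 2) * (∑ x : Site P i, ∑ μ : Fin P.d, ∑ ν : Fin P.d,
            (if μ < ν then ∑ j : Fin N, ∑ k : Fin N, ‖(curl (torusT P i) (fun κ z => V ⟨z, κ⟩) (fun κ z => Y ⟨z, κ⟩) μ ν x) j k‖ ^ 2 else 0)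
          + ∑ x : Site P i, ∑ j : Fin N, ∑ k : Fin N, ‖(divB (torusT P i) (fun κ z => V ⟨z, κ⟩) (fun κ z => Y ⟨z, κ⟩) x) j k‖ ^ 2) := by
  have hV : ∀ b, V b ∈ U1 (Matrix (Fin N) (Fin N) ℂ) := fun b => mem_U1_of_unitary (hVu b)
  -- (1) the Poincaré part (V3-D2)
  have hP := sum_normSq_le_covGrad_of_covLineAvg_eq_zero hV ha hplaq hsmall h Y havg
  -- (2) operator norm ≤ Hilbert–Schmidt size for the covariant derivatives; the dictionary with `covD`
  have hgrad : ∑ b : PBond P i, ∑ ν : Fin P.d, ‖conjR (V ⟨b.src, ν⟩) (Y ⟨b.src.shift ν, b.dir⟩) - Y b‖ ^ 2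
      ≤ ∑ x : Site P i, ∑ μ : Fin P.d, ∑ ν : Fin P.d, ∑ j : Fin N, ∑ k : Fin N,
          ‖(covD (torusT P i) (fun κ z => V ⟨z, κ⟩) ν (fun z => Y ⟨z, μ⟩) x) j k‖ ^ 2 := by
    rw [sum_pbond]
    refine Finset.sum_le_sum fun x _ => Finset.sum_le_sum fun μ _ => Finset.sum_le_sum fun ν _ => ?_
    exact MatrixNorms.opNorm_sq_le_sum_norm_sq _
  -- (3) the Weitzenböck part
  have hU : ∀ (ν : Fin P.d) (x : Site P i), ((fun κ z => V ⟨z, κ⟩) ν x : Matrix (Fin N) (Fin N) ℂ) ∈ unitary (Matrix (Fin N) (Fin N) ℂ) :=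
    fun ν x => hVu _
  have hW := sum_covD_sq_le_curl_sq_add_divB_sq hU (plaqU_hyp ha hplaq) (fun κ z => Y ⟨z, κ⟩)
  -- (4) Hilbert–Schmidt ≤ N·operator norm for the zeroth-order term
  have hzero : ∑ x : Site P i, ∑ μ : Fin P.d, ∑ j : Fin N, ∑ k : Fin N, ‖((fun κ z => Y ⟨z, κ⟩) μ x) j k‖ ^ 2 ≤ N * ∑ b : PBond P i, ‖Y b‖ ^ 2 := by
    rw [sum_pbond, Finset.mul_sum]
    refine Finset.sum_le_sum fun x _ => ?_
    rw [Finset.mul_sum]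
    exact Finset.sum_le_sum fun μ _ => sum_norm_sq_le_mul_opNorm_sq _
  -- assemble
  have hN : (0 : ℝ) ≤ 9 * N / 2 := by positivity
  have hda : (0 : ℝ) ≤ 2 * P.d * a := by positivity
  have h1 := mul_le_mul_of_nonneg_left (hgrad.trans hW) hN
  have h2 := mul_le_mul_of_nonneg_left hzero hda
  have h3 := mul_le_mul_of_nonneg_left h2 hN
  nlinarith [hP, h1, h3]

/-- **AT THE d = 3 CARRIER OF THE ROUTE** (`T3Thm1Carrier.varProblem3 F n K`: `SU(2)` configurations on the finest lattice `Site (F.P K) 0`, `e = K − n` levels,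
background `U₀` read in `M₂(ℂ)` through `unitsField ∘ toUField` with `dist1 (U₀(∂p)) ≤ εL^{−2(K−n)}` — print's (14) non-strict): if `216ε ≤ 1` and the
covariant straight-line block averages of `Y` vanish, then
`L^{−2(K−n)}·Σ_b ‖Y(b)‖² ≤ 18·(Σ_{x,μ<ν} ‖(D_{U₀}Y)(p_{μν}(x))‖²_HS + Σ_x ‖(D*_{U₀}Y)(x)‖²_HS)`
— [B9] Thm 3.11's conclusion «Δ₁ + DRD* + aQ*Q ≥ γ₀η²» in `L²` form on `ker Q` with the full divergence `D*` in place of `RD*`, ABSOLUTE `ε` and constants,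
uniform in `m`, `n`, `K`. [cite: Balaban1985BackgroundPropagators, Thm 3.11 p.416; Balaban1985Variational, (14) p.280] -/
theorem sum_normSq_le_curl_sq_add_divB_sq_T3 (F : T3ContinuumYM3Torus.T3Family) (n K : ℕ)
    (U₀ : GaugeField (F.P K) 0 (Matrix.specialUnitaryGroup (Fin 2) ℂ)) {ε : ℝ} (hε : 0 ≤ ε) (hε1 : 216 * ε ≤ 1)
    (hU : ∀ p : Plaq (F.P K) 0, dist1 (GaugeField.plaqHol U₀ p) ≤ ε * (((F.L : ℝ) ^ (K - n)) ^ 2)⁻¹)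
    (Y : PBond (F.P K) 0 → Matrix (Fin 2) (Fin 2) ℂ)
    (havg : ∀ c : PBond (F.P K) (K - n), ∑ r : Fin (F.P K).d → Fin ((F.P K).L ^ (K - n)), ∑ t ∈ range ((F.P K).L ^ (K - n)),
        conjR (holT (unitsField (toUField U₀)) (Site.fibreSite 0 (K - n) c.src fun _ => ⟨0, pow_pos (F.P K).L_pos (K - n)⟩)
              (treeWord fun ν => ((r ν : ℕ) : ℤ))
            * holT (unitsField (toUField U₀)) (Site.fibreSite 0 (K - n) c.src r) (List.replicate t (c.dir, true)))
          (Y ⟨(fun z : Site (F.P K) 0 => z.shift c.dir)^[t] (Site.fibreSite 0 (K - n) c.src r), c.dir⟩) = 0) :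
    (((F.L : ℝ) ^ (K - n)) ^ 2)⁻¹ * ∑ b : PBond (F.P K) 0, ‖Y b‖ ^ 2
      ≤ 18 * (∑ x : Site (F.P K) 0, ∑ μ : Fin (F.P K).d, ∑ ν : Fin (F.P K).d,
            (if μ < ν then ∑ j : Fin 2, ∑ k : Fin 2,
              ‖(curl (torusT (F.P K) 0) (fun κ z => unitsField (toUField U₀) ⟨z, κ⟩) (fun κ z => Y ⟨z, κ⟩) μ ν x) j k‖ ^ 2 else 0)
          + ∑ x : Site (F.P K) 0, ∑ j : Fin 2, ∑ k : Fin 2,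
              ‖(divB (torusT (F.P K) 0) (fun κ z => unitsField (toUField U₀) ⟨z, κ⟩) (fun κ z => Y ⟨z, κ⟩) x) j k‖ ^ 2) := by
  obtain ⟨-, hplaq⟩ := hyp_of_specialUnitary U₀ hU
  have hVu : ∀ b, (unitsField (toUField U₀) b : Matrix (Fin 2) (Fin 2) ℂ) ∈ unitary (Matrix (Fin 2) (Fin 2) ℂ) :=
    fun b => B7Prop2Explicit.mem_unitaryUnits.mp (unitsField_mem_unitaryUnits (toUField U₀) b)
  have hLF : ((F.P K).L : ℝ) = (F.L : ℝ) := by norm_cast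
  have hd : ((F.P K).d : ℝ) = 3 := by norm_num [T3ContinuumYM3Torus.T3Family.P_d]
  have hL0 : (0 : ℝ) < ((F.L : ℝ) ^ (K - n)) ^ 2 := by
    have : (0 : ℝ) < F.L := by have := F.hL.2; exact_mod_cast (by omega : 0 < F.L)
    positivity
  have e1 : ((F.L : ℝ) ^ (K - n)) ^ 2 * (ε * (((F.L : ℝ) ^ (K - n)) ^ 2)⁻¹) = ε := by
    rw [mul_comm ε, ← mul_assoc, mul_inv_cancel₀ hL0.ne', one_mul]
  have hsmall : ((2 : ℕ) : ℝ) * (F.P K).d ^ 3 * ((((F.P K).L : ℝ) ^ (K - n)) ^ 2 * (ε * (((F.L : ℝ) ^ (K - n)) ^ 2)⁻¹)) ^ 2 ≤ 1 / 2 := by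
    rw [hLF, hd, e1]
    push_cast
    nlinarith [hε1, hε]
  have h := sum_normSq_le_curl_sq_add_divB_sq hVu (by positivity) hplaq hsmall (Prop7FlatCoercivity.sitesPerDir_T3 F n K) Y havg
  rw [hLF, hd] at h
  push_cast at h
  -- the left coefficient: `L^{-2(K-n)} − 9·4·3·εL^{-2(K-n)} = (1 − 108ε)L^{-2(K-n)} ≥ ½L^{-2(K-n)}`
  have hS0 : 0 ≤ ∑ b : PBond (F.P K) 0, ‖Y b‖ ^ 2 := Finset.sum_nonneg fun _ _ => sq_nonneg _
  have hcoef : (1 / 2) * (((F.L : ℝ) ^ (K - n)) ^ 2)⁻¹ ≤ (((F.L : ℝ) ^ (K - n)) ^ 2)⁻¹ - 9 * 2 ^ 2 * 3 * (ε * (((F.L : ℝ) ^ (K - n)) ^ 2)⁻¹) := by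
    have hi : 0 < (((F.L : ℝ) ^ (K - n)) ^ 2)⁻¹ := inv_pos.mpr hL0
    nlinarith [hi, hε1]
  have hR0 : 0 ≤ ∑ x : Site (F.P K) 0, ∑ μ : Fin (F.P K).d, ∑ ν : Fin (F.P K).d,
        (if μ < ν then ∑ j : Fin 2, ∑ k : Fin 2,
          ‖(curl (torusT (F.P K) 0) (fun κ z => unitsField (toUField U₀) ⟨z, κ⟩) (fun κ z => Y ⟨z, κ⟩) μ ν x) j k‖ ^ 2 else 0)
      + ∑ x : Site (F.P K) 0, ∑ j : Fin 2, ∑ k : Fin 2,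
          ‖(divB (torusT (F.P K) 0) (fun κ z => unitsField (toUField U₀) ⟨z, κ⟩) (fun κ z => Y ⟨z, κ⟩) x) j k‖ ^ 2 := by
    refine add_nonneg (Finset.sum_nonneg fun _ _ => Finset.sum_nonneg fun _ _ => Finset.sum_nonneg fun _ _ => ?_)
      (Finset.sum_nonneg fun _ _ => Finset.sum_nonneg fun _ _ => Finset.sum_nonneg fun _ _ => sq_nonneg _)
    split_ifs
    · exact Finset.sum_nonneg fun _ _ => Finset.sum_nonneg fun _ _ => sq_nonneg _
    · exact le_rfl
  have hm := mul_le_mul_of_nonneg_right hcoef hS0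
  nlinarith [h, hm, hR0]

end Thm311

end Summit.QuantumFields.YangMills.Theorems.Prop7CovariantCoercivity

end
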